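import Mathlib
import Summits.NavierStokesRegularity.NavierStokesRegularity.Theorems.OrthantWakeOrthantHopWakeFlux
import HarnessLib

/-!
# `OrthantWake.OrthantHopWake` — support: the bond flux is controlled by the two shell energies it
connects (helper file for item stmt-NavierStokesRegularity-24639; `--supports`)

For the crux `OrthantHopWake` (item 24639) the energy enters the tail above shell `n` only through
the bond flux `Π_n = botSum ε₀ α X n` (`orthantHop_tailFluxBudget`). This file bounds that flux by
the energies of the two shells it connects, uniformly in the table (only `|α_{·,(0,0,1)}| ≤ 1` is
used; no sign condition): for every `θ > 0`,
`|Π_n(u)| ≤ 8 (1+ε₀)^{5n/2} e_n(u) (θ e_{n+1}(u) + 2/θ)`, `e_k = Σ_i ½ X_{i,k}²`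
(Cauchy–Schwarz on the four modes of shell `n`, `|x| ≤ θx²/2 + 1/(2θ)` on shell `n+1`). The free
parameter `θ` is what lets the dissipative cap (`OrthantWakeOrthantHopWakeDissipation`) absorb the
flux into the viscous damping of the tail.

HONEST FRAMING: bookkeeping for Tao-type MODEL lattice ODEs (route OrthantWake, rung TL-M2Break);
the crux is NOT proved here; nothing bears on Navier–Stokes regularity.
-/

noncomputable section

-- the sub-problem namespace `NavierStokesRegularity.NavierStokesRegularity` is the tree's layout (D-0017)
set_option linter.dupNamespace false

namespace Summit.NavierStokesRegularity.NavierStokesRegularity.Theorems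

open Set Filter MeasureTheory intervalIntegral
open scoped Topology
open Literature.Analysis.FluidPDE.TaoCascade

/-! ## The bond flux is controlled by the two shell energies it connects -/

/-- **Bond-flux bound.** If the inter-shell structure constants have modulus `≤ 1`
(`|α_{i₁i₂i₃,(0,0,1)}| ≤ 1`, part of membership in `E₂(R)`), then for every `θ > 0` the bond flux
through `n → n+1` satisfies
`|Π_n(u)| ≤ 8 (1+ε₀)^{5n/2} e_n(u) (θ e_{n+1}(u) + 2/θ)`, where `e_k(u) = Σ_i ½ X_{i,k}(u)²`
(Cauchy–Schwarz over the four modes of shell `n`, and `|x| ≤ θ x²/2 + 1/(2θ)` on shell `n+1`).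
MODEL-lattice bookkeeping; no sign condition on `α` or `X`. [this file] -/
theorem orthantHop_abs_botSum_le {ε₀ : ℝ} (hε : 0 < 1 + ε₀)
    {α : Fin 4 → Fin 4 → Fin 4 → ℤ × ℤ × ℤ → ℝ} (hA : ∀ i₁ i₂ i₃ : Fin 4, |α i₁ i₂ i₃ (0, 0, 1)| ≤ 1)
    (X : Fin 4 → ℤ → ℝ → ℝ) (n : ℤ) (u : ℝ) {θ : ℝ} (hθ : 0 < θ) :
    |botSum ε₀ α X n u| ≤ 8 * (1 + ε₀) ^ ((5 : ℝ) * n / 2) *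
      (∑ i : Fin 4, (1 / 2 : ℝ) * X i n u ^ 2) *
        (θ * (∑ i : Fin 4, (1 / 2 : ℝ) * X i (n + 1) u ^ 2) + 2 / θ) := by
  set s : ℝ := (1 + ε₀) ^ ((5 : ℝ) * n / 2) with hs
  have hs0 : 0 ≤ s := (Real.rpow_pos_of_pos hε _).le
  set SA : ℝ := ∑ i : Fin 4, |X i n u| with hSA
  set SB : ℝ := ∑ i : Fin 4, |X i (n + 1) u| with hSB
  clear_value s SA SB
  have hSB0 : 0 ≤ SB := hSB ▸ Finset.sum_nonneg fun i _ => abs_nonneg _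
  -- step 1a: triangle inequality and `|α| ≤ 1`
  have h1a : |botSum ε₀ α X n u| ≤ ∑ i₁ : Fin 4, ∑ i₂ : Fin 4, ∑ i₃ : Fin 4,
      s * (|X i₁ n u| * |X i₂ n u| * |X i₃ (n + 1) u|) := by
    unfold botSum
    rw [← hs]
    refine (Finset.abs_sum_le_sum_abs _ _).trans (Finset.sum_le_sum fun i₁ _ => ?_)
    refine (Finset.abs_sum_le_sum_abs _ _).trans (Finset.sum_le_sum fun i₂ _ => ?_)
    refine (Finset.abs_sum_le_sum_abs _ _).trans (Finset.sum_le_sum fun i₃ _ => ?_)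
    rw [abs_mul, abs_mul, abs_of_nonneg hs0, abs_mul, abs_mul]
    have hprod : 0 ≤ s * (|X i₁ n u| * |X i₂ n u| * |X i₃ (n + 1) u|) := by positivity
    calc |α i₁ i₂ i₃ (0, 0, 1)| * s * (|X i₁ n u| * |X i₂ n u| * |X i₃ (n + 1) u|)
        = |α i₁ i₂ i₃ (0, 0, 1)| * (s * (|X i₁ n u| * |X i₂ n u| * |X i₃ (n + 1) u|)) := by ring
      _ ≤ 1 * (s * (|X i₁ n u| * |X i₂ n u| * |X i₃ (n + 1) u|)) :=
          mul_le_mul_of_nonneg_right (hA i₁ i₂ i₃) hprod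
      _ = s * (|X i₁ n u| * |X i₂ n u| * |X i₃ (n + 1) u|) := one_mul _
  -- step 1b: the triple sum factorises
  have h1b : (∑ i₁ : Fin 4, ∑ i₂ : Fin 4, ∑ i₃ : Fin 4,
      s * (|X i₁ n u| * |X i₂ n u| * |X i₃ (n + 1) u|)) = s * (SA * SA * SB) := by
    have e3 : ∀ i₁ i₂ : Fin 4, (∑ i₃ : Fin 4, s * (|X i₁ n u| * |X i₂ n u| * |X i₃ (n + 1) u|)) =
        s * |X i₁ n u| * |X i₂ n u| * SB := by
      intro i₁ i₂
      rw [hSB, Finset.mul_sum]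
      exact Finset.sum_congr rfl fun i₃ _ => by ring
    have e2 : ∀ i₁ : Fin 4, (∑ i₂ : Fin 4, s * |X i₁ n u| * |X i₂ n u| * SB) =
        s * |X i₁ n u| * SA * SB := by
      intro i₁
      rw [hSA, Finset.mul_sum, Finset.sum_mul]
    have e1 : (∑ i₁ : Fin 4, s * |X i₁ n u| * SA * SB) = s * (SA * SA * SB) := by
      have : (∑ i₁ : Fin 4, s * |X i₁ n u| * SA * SB) =
          (∑ i₁ : Fin 4, s * |X i₁ n u|) * (SA * SB) := by
        rw [Finset.sum_mul]
        exact Finset.sum_congr rfl fun _ _ => by ring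
      rw [this, ← Finset.mul_sum, ← hSA]
      ring
    calc (∑ i₁ : Fin 4, ∑ i₂ : Fin 4, ∑ i₃ : Fin 4,
          s * (|X i₁ n u| * |X i₂ n u| * |X i₃ (n + 1) u|))
        = ∑ i₁ : Fin 4, ∑ i₂ : Fin 4, s * |X i₁ n u| * |X i₂ n u| * SB :=
          Finset.sum_congr rfl fun i₁ _ => Finset.sum_congr rfl fun i₂ _ => e3 i₁ i₂
      _ = ∑ i₁ : Fin 4, s * |X i₁ n u| * SA * SB := Finset.sum_congr rfl fun i₁ _ => e2 i₁
      _ = s * (SA * SA * SB) := e1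
  -- step 2: Cauchy–Schwarz on shell `n`: `SA² ≤ 4 Σ |x|² = 8 e_n`
  have h2 : SA * SA ≤ 8 * ∑ i : Fin 4, (1 / 2 : ℝ) * X i n u ^ 2 := by
    have h4 : SA * SA ≤ 4 * ∑ i : Fin 4, |X i n u| ^ 2 := by
      rw [hSA, Fin.sum_univ_four, Fin.sum_univ_four]
      nlinarith [sq_nonneg (|X 0 n u| - |X 1 n u|), sq_nonneg (|X 0 n u| - |X 2 n u|),
        sq_nonneg (|X 0 n u| - |X 3 n u|), sq_nonneg (|X 1 n u| - |X 2 n u|),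
        sq_nonneg (|X 1 n u| - |X 3 n u|), sq_nonneg (|X 2 n u| - |X 3 n u|)]
    calc SA * SA ≤ 4 * ∑ i : Fin 4, |X i n u| ^ 2 := h4
      _ = 8 * ∑ i : Fin 4, (1 / 2 : ℝ) * X i n u ^ 2 := by
          rw [Finset.mul_sum, Finset.mul_sum]
          exact Finset.sum_congr rfl fun i _ => by rw [sq_abs]; ring
  -- step 3: `|x| ≤ θx²/2 + 1/(2θ)` on shell `n+1`: `SB ≤ θ e_{n+1} + 2/θ`
  have h3 : SB ≤ θ * (∑ i : Fin 4, (1 / 2 : ℝ) * X i (n + 1) u ^ 2) + 2 / θ := by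
    have hone : ∀ i : Fin 4, |X i (n + 1) u| ≤ θ * ((1 / 2 : ℝ) * X i (n + 1) u ^ 2) + 1 / (2 * θ) := by
      intro i
      have hk : 0 ≤ (θ * |X i (n + 1) u| - 1) ^ 2 / (2 * θ) := by positivity
      have hrepr : (θ * |X i (n + 1) u| - 1) ^ 2 / (2 * θ) =
          θ * ((1 / 2 : ℝ) * X i (n + 1) u ^ 2) + 1 / (2 * θ) - |X i (n + 1) u| := by
        rw [← sq_abs (X i (n + 1) u)]
        field_simp
        ring
      linarith
    have hsum : ∑ i : Fin 4, (θ * ((1 / 2 : ℝ) * X i (n + 1) u ^ 2) + 1 / (2 * θ)) =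
        θ * (∑ i : Fin 4, (1 / 2 : ℝ) * X i (n + 1) u ^ 2) + 2 / θ := by
      rw [Finset.sum_add_distrib, ← Finset.mul_sum, Finset.sum_const, Finset.card_univ,
        Fintype.card_fin, nsmul_eq_mul]
      have h4 : ((4 : ℕ) : ℝ) * (1 / (2 * θ)) = 2 / θ := by
        rw [one_div, ← div_eq_mul_inv, div_eq_div_iff (by positivity) hθ.ne']
        push_cast
        ring
      rw [h4]
    calc SB = ∑ i : Fin 4, |X i (n + 1) u| := hSB
      _ ≤ ∑ i : Fin 4, (θ * ((1 / 2 : ℝ) * X i (n + 1) u ^ 2) + 1 / (2 * θ)) :=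
          Finset.sum_le_sum fun i _ => hone i
      _ = θ * (∑ i : Fin 4, (1 / 2 : ℝ) * X i (n + 1) u ^ 2) + 2 / θ := hsum
  -- combine
  have hE0 : 0 ≤ ∑ i : Fin 4, (1 / 2 : ℝ) * X i n u ^ 2 :=
    Finset.sum_nonneg fun i _ => by positivity
  calc |botSum ε₀ α X n u|
      ≤ ∑ i₁ : Fin 4, ∑ i₂ : Fin 4, ∑ i₃ : Fin 4,
          s * (|X i₁ n u| * |X i₂ n u| * |X i₃ (n + 1) u|) := h1a
    _ = s * (SA * SA) * SB := by rw [h1b]; ring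
    _ ≤ s * (8 * ∑ i : Fin 4, (1 / 2 : ℝ) * X i n u ^ 2) *
          (θ * (∑ i : Fin 4, (1 / 2 : ℝ) * X i (n + 1) u ^ 2) + 2 / θ) :=
        mul_le_mul (mul_le_mul_of_nonneg_left h2 hs0) h3 hSB0
          (mul_nonneg hs0 (mul_nonneg (by norm_num) hE0))
    _ = 8 * s * (∑ i : Fin 4, (1 / 2 : ℝ) * X i n u ^ 2) *
          (θ * (∑ i : Fin 4, (1 / 2 : ℝ) * X i (n + 1) u ^ 2) + 2 / θ) := by ring

end Summit.NavierStokesRegularity.NavierStokesRegularity.Theorems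

end
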